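import Literature.AlgebraicGeometry.Frobenioids.CdIsFrobenioid
import Literature.AlgebraicGeometry.Frobenioids.SupportsRatAction
import Literature.AlgebraicGeometry.Frobenioids.SupportsRealActionFunctor
import HarnessLib

/-!
# Frobenioids I, Proposition 2.5 (iii) for `Λ = ℚ` (the printed generality "`d ∈ Λ_{>0}`, `Λ` supports `Φ`")

Mochizuki, *The geometry of Frobenioids I: the general theory*, Kyushu J. Math. **62** (2008)
293–400, §2, Proposition 2.5 (iii), p. 48 l. 39 – p. 49 l. 9 [cite: MochizukiFrdI2008, Prop. 2.5(iii) p.49]: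
"Let `τ` be a characteristic splitting on `C`; `Λ` a monoid type that supports `Φ`; `d ∈ Λ_{>0}`.
Suppose that the Frobenioid `C` is of Frobenius-normalized, metrically trivial, and Aut-ample type.
Then: … (iii) There exists an equivalence of categories `Ψ : C ⥲ C(d)` — … the unit-linear Frobenius
functor [associated to `τ`, `d`] — that satisfies …: (a) `Ψ` acts as the identity on objects and
isometries of `C`; (b) `Ψ` is 1-compatible, relative to the functors `C → F_Φ`, `C(d) → F_{d·Φ} =
(F_Φ)(d) ⊆ F_Φ` with the Frobenius functor associated to `d` on `F_Φ` [which implies, in particular,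
that `C(d)`, equipped with the natural functor `C(d) → F_{d·Φ}`, is a Frobenioid]."

The named statements `PreFrobenioid.UnitLinearFrobeniusExists d` / `CdIsFrobenioid d`
(`CharacteristicSplitting.lean`, abc-iut-L1-t2) type the case `Λ = ℤ` and record `Λ = ℚ, ℝ` as
TODO(general form); `Λ = ℝ` is `unitLinearFrobeniusExists_realPow` (`UnitLinearFrobeniusReal.lean`,
abc-iut-L6-t9).  This PROOF-ONLY file (seat abc-iut-L1-t12, row «P25-Λℚ», L1-lead R109 (3)(f)) closes the
TODO for `Λ = ℚ`: for a monoid `Φ` on `D` supported by `ℚ` (`hS`, Def. 2.4 (ii)(b): every `Φ(A)` perfect) and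
`d ∈ ℚ_{>0}`, "multiplication by `d`" is `ratPowEnd Φ hS d` (`SupportsRatAction.lean`), injective on every
`Φ(A)`, so the L6-t9 lineage's general-`δ` theorems (`unitLinearFrobeniusData_isEquivalence`,
`unitLinearFrobeniusData_oneCommutes`, `isFrobenioid_cd`) give the unit-linear Frobenius functor
`Ψ : C ⥲ C(d)` with (a), (b), and "`C(d) → F_{d·Φ}` is a Frobenioid".  Consistency: on `d ∈ ℕ_{≥1}` the
rational and integral functors agree (`ratPowEnd_pnat`), and on a monoid supported by `ℝ` the real action
restricts to the rational one (`Supports.realPow_nnratCast`, `realPowEnd_nnratCast`), so the three printed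
cases `Λ = ℤ ⊆ ℚ ⊆ ℝ` of Def. 2.4 (ii) are ONE action.  No new definitions.
-/

noncomputable section

namespace Literature.AlgebraicGeometry.Frobenioids

open CategoryTheory Opposite

universe w v v' u u'

/-! ### `Λ = ℚ ⊆ ℝ`: the real action restricts to the rational one -/

namespace Supports

variable {M : Type u} [CommMonoid M]

/-- On a monoid supported by `ℝ` (hence perfect), `a^q` for `q ∈ ℚ_{≥0} ⊆ ℝ_{≥0}` computed with the
`ℝ`-action IS the `ℚ`-action power: `(a^q)^n = a^{nq} = a^m` for `q = m/n` pins it down.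
[cite: MochizukiFrdI2008, Def. 2.4(ii) p.48] -/
theorem realPow_nnratCast (hS : Supports M .R) (q : ℚ≥0) (a : M) :
    hS.realPow (q : NNReal) a = hS.supportsQ_of_R.isPerfect_Q.ratPow q a := by
  obtain ⟨m, n, hn, rfl⟩ := nnrat_exists_eq_natCast_div q
  refine hS.supportsQ_of_R.isPerfect_Q.eq_ratPow_of_pow_eq hn rfl ?_
  have hcast : ((n : NNReal)) * (((m : ℚ≥0) / (n : ℚ≥0) : ℚ≥0) : NNReal) = m := by
    rw [NNRat.cast_div, NNRat.cast_natCast, NNRat.cast_natCast,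
      mul_div_cancel₀ _ (Nat.cast_ne_zero.mpr hn.ne')]
  rw [← hS.realPow_natCast n, ← hS.realPow_mul, hcast, hS.realPow_natCast]

end Supports

/-- "Multiplication by `q ∈ ℚ_{>0}`" on a monoid on `D` supported by `ℝ` is the same endomorphism whether
computed with the `ℝ`-action (`realPowEnd`, abc-iut-L1-d2) or the `ℚ`-action (`ratPowEnd`).
[cite: MochizukiFrdI2008, Def. 2.4(iii) p.48] -/
theorem realPowEnd_nnratCast {D : Type u} [Category.{v} D] (Φ : Dᵒᵖ ⥤ CommMonCat.{w})
    (hS : ∀ X : Dᵒᵖ, Supports (Φ.obj X) .R) (q : ℚ≥0) :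
    realPowEnd Φ hS (q : NNReal) = ratPowEnd Φ (fun X => (hS X).supportsQ_of_R) q := by
  ext X a
  exact (hS X).realPow_nnratCast q a

namespace PreFrobenioid

variable {D : Type u} [Category.{v} D] {Φ : Dᵒᵖ ⥤ CommMonCat.{w}}
  {C : Type u'} [Category.{v'} C] {F : C ⥤ ElemFrobenioid Φ}

namespace CharacteristicSplitting

variable (hF : IsFrobenioid F) (τ : CharacteristicSplitting F) (hmt : IsOfType (IsMetricallyTrivial F))
  (haa : IsOfType (IsAutAmple F)) (hnorm : IsOfType (IsFrobeniusNormalized F))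
  (hS : ∀ X : Dᵒᵖ, Supports (Φ.obj X) .Q) {d : ℚ≥0} (hd : d ≠ 0)

include hF τ hmt haa hnorm hS hd

/-- **Prop. 2.5 (iii) for `Λ = ℚ`, `d ∈ ℚ_{>0}`**: the unit-linear Frobenius functor
`Ψ : C → C(d)` (`unitLinearFrobeniusData` at `δ :=` multiplication by `d`) is an equivalence of
categories. [cite: MochizukiFrdI2008, Prop. 2.5(iii) p.49] -/
theorem unitLinearFrobeniusData_isEquivalence_ratPow :
    (unitLinearFrobeniusData hF τ hmt haa (ratPowEnd Φ hS d) hnorm).functor.IsEquivalence :=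
  unitLinearFrobeniusData_isEquivalence hF τ hmt haa (ratPowEnd Φ hS d) hnorm
    (ratPowEnd_app_injective Φ hS hd)

/-- **Prop. 2.5 (iii), bracket, for `Λ = ℚ`**: `C(d)`, equipped with `C(d) → F_{d·Φ}`, is a Frobenioid.
[cite: MochizukiFrdI2008, Prop. 2.5(iii) p.49] -/
theorem isFrobenioid_cd_ratPow : IsFrobenioid (cdToElem F (ratPowEnd Φ hS d)) :=
  isFrobenioid_cd hF τ hmt haa (ratPowEnd Φ hS d) hnorm (ratPowEnd_app_injective Φ hS hd)

end CharacteristicSplitting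

/-- **Prop. 2.5 (iii) in the printed generality `Λ = ℚ`** (`Λ` supports `Φ`, i.e. every `Φ(A)` perfect;
`d ∈ Λ_{>0}`): for every characteristic splitting `τ` on a Frobenioid `C → F_Φ` of Frobenius-normalized,
metrically trivial and `Aut`-ample type there exists an equivalence `Ψ : C ⥲ C(d)` which (a) acts as the
identity on objects and isometries and (b) is `1`-compatible — with identity components — relative to
`C → F_Φ`, `C(d) → F_{d·Φ} ⊆ F_Φ`, with the Frobenius functor "multiplication by `d`" on `F_Φ`; and
`C(d) → F_{d·Φ}` is a Frobenioid.  (Same shape as the landed `UnitLinearFrobeniusExists d ∧ CdIsFrobenioid d`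
for `d ∈ ℕ_{≥1}` and `unitLinearFrobeniusExists_realPow` for `d ∈ ℝ_{>0}`, with `ratPowEnd Φ hS d` as the
endomorphism.) [cite: MochizukiFrdI2008, Prop. 2.5(iii) p.49] -/
theorem unitLinearFrobeniusExists_ratPow (hS : ∀ X : Dᵒᵖ, Supports (Φ.obj X) .Q) {d : ℚ≥0}
    (hd : d ≠ 0) (τ : CharacteristicSplitting F) (hF : IsFrobenioid F)
    (hnorm : IsOfType (IsFrobeniusNormalized F)) (hmt : IsOfType (IsMetricallyTrivial F))
    (haa : IsOfType (IsAutAmple F)) :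
    (∃ U : UnitLinearFrobeniusData F (ratPowEnd Φ hS d), U.functor.IsEquivalence ∧
      OneCommutes U.functor (wideSubcategoryInclusion (divIn F (ratPowEnd Φ hS d)) ⋙ F) F
        (ElemFrobenioid.mapEnd (ratPowEnd Φ hS d))) ∧
      IsFrobenioid (cdToElem F (ratPowEnd Φ hS d)) :=
  ⟨⟨CharacteristicSplitting.unitLinearFrobeniusData hF τ hmt haa (ratPowEnd Φ hS d) hnorm,
    CharacteristicSplitting.unitLinearFrobeniusData_isEquivalence_ratPow hF τ hmt haa hnorm hS hd,
    CharacteristicSplitting.unitLinearFrobeniusData_oneCommutes hF τ hmt haa (ratPowEnd Φ hS d) hnorm⟩,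
    CharacteristicSplitting.isFrobenioid_cd_ratPow hF τ hmt haa hnorm hS hd⟩

/-- Consistency with the case `Λ = ℤ`: for `d ∈ ℕ_{≥1} ⊆ ℚ_{>0}` the rational Frobenius endomorphism IS
`powEnd Φ d`, so the two unit-linear Frobenius functors coincide. [cite: MochizukiFrdI2008, Def. 2.4(iii) p.48] -/
theorem unitLinearFrobeniusData_ratPow_pnat (hS : ∀ X : Dᵒᵖ, Supports (Φ.obj X) .Q) (d : ℕ+)
    (τ : CharacteristicSplitting F) (hF : IsFrobenioid F)
    (hnorm : IsOfType (IsFrobeniusNormalized F)) (hmt : IsOfType (IsMetricallyTrivial F))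
    (haa : IsOfType (IsAutAmple F)) :
    HEq (CharacteristicSplitting.unitLinearFrobeniusData hF τ hmt haa (ratPowEnd Φ hS ((d : ℕ) : ℚ≥0)) hnorm)
      (CharacteristicSplitting.unitLinearFrobeniusData hF τ hmt haa (powEnd Φ d) hnorm) := by
  rw [ratPowEnd_pnat]

/-- Consistency with the case `Λ = ℝ`: on a monoid supported by `ℝ`, for `q ∈ ℚ_{>0} ⊆ ℝ_{>0}` the real and
rational unit-linear Frobenius functors coincide. [cite: MochizukiFrdI2008, Def. 2.4(iii) p.48] -/
theorem unitLinearFrobeniusData_realPow_nnratCast (hS : ∀ X : Dᵒᵖ, Supports (Φ.obj X) .R) (q : ℚ≥0)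
    (τ : CharacteristicSplitting F) (hF : IsFrobenioid F)
    (hnorm : IsOfType (IsFrobeniusNormalized F)) (hmt : IsOfType (IsMetricallyTrivial F))
    (haa : IsOfType (IsAutAmple F)) :
    HEq (CharacteristicSplitting.unitLinearFrobeniusData hF τ hmt haa (realPowEnd Φ hS (q : NNReal)) hnorm)
      (CharacteristicSplitting.unitLinearFrobeniusData hF τ hmt haa
        (ratPowEnd Φ (fun X => (hS X).supportsQ_of_R) q) hnorm) := by
  rw [realPowEnd_nnratCast]

/-- **The printed use case `Λ = ℚ`: THE perfection.**  For a Frobenioid `C' → F_{Φ^pf}` over THE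
perfected divisor monoid (e.g. `C^pf`, [FrdI] Prop. 3.2/5.5; [FrdII] Ex. 3.3 (ii) `C^ℚ := C^pf`) of
Frobenius-normalized, metrically trivial and `Aut`-ample type, and `d ∈ ℚ_{>0}`, the unit-linear Frobenius
functor `C' ⥲ C'(d)` exists — `ℚ` supports `Φ^pf` automatically (`supportsQ_perfectionFunctor`).
[cite: MochizukiFrdI2008, Prop. 2.5(iii) p.49] -/
theorem unitLinearFrobeniusExists_ratPow_perfection {C' : Type u'} [Category.{v'} C']
    {F' : C' ⥤ ElemFrobenioid (perfectionFunctor Φ)} {d : ℚ≥0} (hd : d ≠ 0)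
    (τ : CharacteristicSplitting F') (hF : IsFrobenioid F')
    (hnorm : IsOfType (IsFrobeniusNormalized F')) (hmt : IsOfType (IsMetricallyTrivial F'))
    (haa : IsOfType (IsAutAmple F')) :
    (∃ U : UnitLinearFrobeniusData F' (ratPowEnd (perfectionFunctor Φ) (supportsQ_perfectionFunctor Φ) d),
        U.functor.IsEquivalence ∧
      OneCommutes U.functor
        (wideSubcategoryInclusion (divIn F' (ratPowEnd _ (supportsQ_perfectionFunctor Φ) d)) ⋙ F') F'
        (ElemFrobenioid.mapEnd (ratPowEnd _ (supportsQ_perfectionFunctor Φ) d))) ∧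
      IsFrobenioid (cdToElem F' (ratPowEnd _ (supportsQ_perfectionFunctor Φ) d)) :=
  unitLinearFrobeniusExists_ratPow (supportsQ_perfectionFunctor Φ) hd τ hF hnorm hmt haa

end PreFrobenioid

end Literature.AlgebraicGeometry.Frobenioids

end
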